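import Mathlib.NumberTheory.NumberField.InfinitePlace.Embeddings
import Mathlib.Analysis.Complex.Basic
import Mathlib.Data.Multiset.Basic
import HarnessLib

-- provenance: harness21/H21/H21/Prelude/AutomorphicAxiomatic/InfinityType.lean @ 1958e9d (interim HEAD d8f2665); M5 mechanical rewrite
/-!
# Infinity types and Buzzard–Gee algebraicity (trunk G19: AutomorphicAxiomatic)

This file sets up the *archimedean-parameter side* of the algebraicity vocabulary for
automorphic representations of `GL n` over a number field `K`, following

* K. Buzzard, T. Gee, *The conjectural connections between automorphic representations and
  Galois representations* (2014), Definitions 3.1.1, 5.3.2, 5.3.3;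
* L. Clozel, *Motifs et formes automorphes* (1990), Définition 1.8 and 3.12.

## Contents

* `Literature.NumberTheory.Automorphic.ArchWeight`: a pair `(a, b)` of complex numbers with `a - b ∈ ℤ`, encoding the
  character `z ↦ z ^ a * conj z ^ b` of `ℂˣ` (well defined precisely when `a - b ∈ ℤ`).
* `Literature.Automorphic.InfinityType K n`: for each complex embedding `σ : K →+* ℂ`, a multiset of
  archimedean weights (the restriction to `ℂˣ ⊆ W_ℝ` or `W_ℂ` of the Langlands parameter of `π_σ`).
* Predicates `IsWellFormed`, `IsLAlgebraic`, `IsCAlgebraic`, `IsRegular`, `IsRegularAlgebraic`,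
  the twist `InfinityType.twist`, and the associated multiset of Hodge–Tate weights
  `InfinityType.hodgeTateWeights`.
* Lemmas `isCAlgebraic_iff_isLAlgebraic_twist` (Buzzard–Gee: `π` is C-algebraic iff
  `π ⊗ |det|^((n-1)/2)` is L-algebraic), `hodgeTateWeights_mem_int_of_isLAlgebraic`,
  `IsRegular.nodup_hodgeTateWeights`.

## Design notes

* Mathlib has complex embeddings `K →+* ℂ` and their conjugates
  `NumberField.ComplexEmbedding.conjugate` (used in `IsWellFormed`), but no notion of infinity type
  or of L/C-algebraicity; everything below is new.
* An `InfinityType` here is *free parameter data*: attaching an infinity type to the archimedean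
  component `π_∞` of an automorphic representation requires the archimedean local Langlands
  correspondence, i.e. the theory of `(𝔤, K)`-modules (tier L, excluded from H21 v0). Consequently
  the downstream statements needing "`π` is regular algebraic" (lang.S27, lang.S02, lang.S03) are
  deferred.
* Hodge–Tate weight convention: the weight attached to the parameter `z ↦ z ^ a * conj z ^ b` at `σ`
  is `-a`, so that the cyclotomic character (corresponding to `|·|`, parameter `a = b = 1` after the
  L-normalised twist) has Hodge–Tate weight `-1`. This matches the convention of the G09 `PAdicHodge`
  prelude (Buzzard–Gee 2014, §2.1 and Remark 3.1.3) by citation only; no import is needed.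
-/

namespace Literature.NumberTheory.Automorphic

/-- An *archimedean weight*: a pair of complex numbers `(a, b)` with `a - b ∈ ℤ`. It encodes the
quasi-character `z ↦ z ^ a * conj z ^ b := |z| ^ (a + b) * (z / |z|) ^ (a - b)` of `ℂˣ`, which is
well defined exactly when `a - b` is an integer (Buzzard–Gee 2014, §3.1; Clozel 1990, §1.8). [cite: BuzzardGee2014, §3.1] -/
@[ext]
structure ArchWeight where
  /-- The exponent of `z`. -/
  a : ℂ
  /-- The exponent of `conj z`. -/
  b : ℂ
  /-- The side condition `a - b ∈ ℤ` making `z ↦ z ^ a * conj z ^ b` well defined. -/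
  exists_int_sub : ∃ m : ℤ, a - b = m

namespace ArchWeight

/-- Swap the two exponents: `(a, b) ↦ (b, a)`, i.e. precompose the character with complex
conjugation on `ℂˣ` (Buzzard–Gee 2014, §3.1). [cite: BuzzardGee2014, §3.1] -/
def swap (p : ArchWeight) : ArchWeight where
  a := p.b
  b := p.a
  exists_int_sub := by
    obtain ⟨m, hm⟩ := p.exists_int_sub
    exact ⟨-m, by rw [Int.cast_neg, ← hm]; ring⟩

/-- The `a`-exponent of the swap (Buzzard–Gee 2014, §3.1). [cite: BuzzardGee2014, §3.1] -/
@[simp] lemma swap_a (p : ArchWeight) : p.swap.a = p.b := rfl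

/-- The `b`-exponent of the swap (Buzzard–Gee 2014, §3.1). [cite: BuzzardGee2014, §3.1] -/
@[simp] lemma swap_b (p : ArchWeight) : p.swap.b = p.a := rfl

/-- `swap` is an involution (Buzzard–Gee 2014, §3.1). [cite: BuzzardGee2014, §3.1] -/
@[simp] lemma swap_swap (p : ArchWeight) : p.swap.swap = p := rfl

/-- Twist by `|·|_ℂ ^ s = (z conj z) ^ s`, i.e. `(a, b) ↦ (a + s, b + s)`; the side condition
`a - b ∈ ℤ` is preserved (Buzzard–Gee 2014, §3.1 and Definition 5.3.3). [cite: BuzzardGee2014, §3.1 and Definition 5.3.3] -/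
def twist (p : ArchWeight) (s : ℂ) : ArchWeight where
  a := p.a + s
  b := p.b + s
  exists_int_sub := by
    obtain ⟨m, hm⟩ := p.exists_int_sub
    exact ⟨m, by rw [← hm]; ring⟩

/-- The `a`-exponent of a twist (Buzzard–Gee 2014, §3.1). [cite: BuzzardGee2014, §3.1] -/
@[simp] lemma twist_a (p : ArchWeight) (s : ℂ) : (p.twist s).a = p.a + s := rfl

/-- The `b`-exponent of a twist (Buzzard–Gee 2014, §3.1). [cite: BuzzardGee2014, §3.1] -/
@[simp] lemma twist_b (p : ArchWeight) (s : ℂ) : (p.twist s).b = p.b + s := rfl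

/-- Twisting by `0` does nothing (Buzzard–Gee 2014, §3.1). [cite: BuzzardGee2014, §3.1] -/
@[simp] lemma twist_zero (p : ArchWeight) : p.twist 0 = p := by
  ext <;> simp

/-- Twists compose additively (Buzzard–Gee 2014, §3.1). [cite: BuzzardGee2014, §3.1] -/
lemma twist_twist (p : ArchWeight) (s t : ℂ) : (p.twist s).twist t = p.twist (s + t) := by
  ext <;> simp [add_assoc]

end ArchWeight

/-- An *infinity type* for `GL n` over the number field `K`: for each complex embedding
`σ : K →+* ℂ`, a multiset of archimedean weights, to be thought of as the restriction to `ℂˣ` of the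
Langlands parameter of the archimedean component `π_v` at the place `v` under `σ`
(Buzzard–Gee 2014, §3.1; Clozel 1990, §3.3). The parameter `n` only enters through the
well-formedness predicate `InfinityType.IsWellFormed`. [cite: BuzzardGee2014, §3.1] -/
@[nolint unusedArguments]
def InfinityType (K : Type*) [Field K] (_n : ℕ) : Type _ :=
  (K →+* ℂ) → Multiset ArchWeight

namespace InfinityType

variable {K : Type*} [Field K] {n : ℕ}

/-- An infinity type is *well formed* if it has exactly `n` weights at every embedding and is
compatible with complex conjugation: the weights at `conj ∘ σ` are the swaps of the weights at `σ`
(so at a real place the multiset is `swap`-stable) (Buzzard–Gee 2014, §3.1; Clozel 1990, §3.3). [cite: BuzzardGee2014, §3.1] -/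
def IsWellFormed (T : InfinityType K n) : Prop :=
  (∀ σ : K →+* ℂ, Multiset.card (T σ) = n) ∧
    ∀ σ : K →+* ℂ, T (NumberField.ComplexEmbedding.conjugate σ) = (T σ).map ArchWeight.swap

/-- *L-algebraic*: all exponents `a, b` at all embeddings are integers
(Buzzard–Gee 2014, Definition 3.1.1 and Definition 5.3.2). [cite: BuzzardGee2014, Definition 3.1.1 and Definition 5.3.2] -/
def IsLAlgebraic (T : InfinityType K n) : Prop :=
  ∀ σ : K →+* ℂ, ∀ p ∈ T σ, ∃ k l : ℤ, p.a = k ∧ p.b = l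

/-- *C-algebraic*: all exponents `a, b` at all embeddings lie in `(n - 1) / 2 + ℤ`
(Buzzard–Gee 2014, Definition 3.1.1 and Definition 5.3.3; this is Clozel's "algébrique",
Clozel 1990, Définition 1.8). [cite: BuzzardGee2014, Definition 3.1.1 and Definition 5.3.3] -/
def IsCAlgebraic (T : InfinityType K n) : Prop :=
  ∀ σ : K →+* ℂ, ∀ p ∈ T σ, ∃ k l : ℤ,
    p.a = k + ((n : ℂ) - 1) / 2 ∧ p.b = l + ((n : ℂ) - 1) / 2

/-- *Regular*: at every embedding the exponents `a` of the `n` weights are pairwise distinct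
(Clozel 1990, Définition 3.12; Buzzard–Gee 2014, §3.1). [cite: Clozel1990, Définition 3.12] -/
def IsRegular (T : InfinityType K n) : Prop :=
  ∀ σ : K →+* ℂ, ((T σ).map ArchWeight.a).Nodup

/-- *Regular algebraic* in the sense of Clozel: C-algebraic and regular
(Clozel 1990, Définitions 1.8 and 3.12). [cite: Clozel1990, Définitions 1.8 and 3.12] -/
def IsRegularAlgebraic (T : InfinityType K n) : Prop :=
  T.IsCAlgebraic ∧ T.IsRegular

/-- Twist an infinity type by `|det| ^ s`: every weight `(a, b)` becomes `(a + s, b + s)`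
(Buzzard–Gee 2014, §3.1 and §5.3). [cite: BuzzardGee2014, §3.1 and §5.3] -/
def twist (T : InfinityType K n) (s : ℂ) : InfinityType K n :=
  fun σ ↦ (T σ).map fun p ↦ p.twist s

/-- Unfolding the twist of an infinity type at an embedding (Buzzard–Gee 2014, §3.1). [cite: BuzzardGee2014, §3.1] -/
@[simp] lemma twist_apply (T : InfinityType K n) (s : ℂ) (σ : K →+* ℂ) :
    T.twist s σ = (T σ).map fun p ↦ p.twist s := rfl

/-- The multiset of (expected) *Hodge–Tate weights* at the embedding `σ` of an infinity type: the
weight `(a, b)` contributes `-a`. Convention: the cyclotomic character has Hodge–Tate weight `-1`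
(Buzzard–Gee 2014, Remark 3.1.3 and Conjecture 3.2.2; matches the G09 `PAdicHodge` prelude). [cite: BuzzardGee2014, Remark 3.1.3 and Conjecture 3.2.2] -/
def hodgeTateWeights (T : InfinityType K n) (σ : K →+* ℂ) : Multiset ℂ :=
  (T σ).map fun p ↦ -p.a

/-- Buzzard–Gee: an infinity type is C-algebraic iff its twist by `|det| ^ ((n - 1) / 2)` is
L-algebraic (Buzzard–Gee 2014, §5.3, discussion after Definition 5.3.3). [cite: BuzzardGee2014, §5.3  discussion after Definition 5.3.3] -/
theorem isCAlgebraic_iff_isLAlgebraic_twist (T : InfinityType K n) :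
    T.IsCAlgebraic ↔ (T.twist (((n : ℂ) - 1) / 2)).IsLAlgebraic := by
  simp only [IsCAlgebraic, IsLAlgebraic, twist_apply, Multiset.forall_mem_map_iff,
    ArchWeight.twist_a, ArchWeight.twist_b]
  refine forall_congr' fun σ ↦ forall₂_congr fun p _ ↦ ?_
  constructor
  · rintro ⟨k, l, hk, hl⟩
    exact ⟨k + (n - 1 : ℤ), l + (n - 1 : ℤ), by rw [hk]; push_cast; ring,
      by rw [hl]; push_cast; ring⟩
  · rintro ⟨k, l, hk, hl⟩
    exact ⟨k - (n - 1 : ℤ), l - (n - 1 : ℤ), by push_cast; linear_combination hk,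
      by push_cast; linear_combination hl⟩

/-- Twisting is additive in the twisting parameter (Buzzard–Gee 2014, §3.1). [cite: BuzzardGee2014, §3.1] -/
lemma twist_twist (T : InfinityType K n) (s t : ℂ) :
    (T.twist s).twist t = T.twist (s + t) := by
  funext σ
  simp [Multiset.map_map, ArchWeight.twist_twist]

/-- The Hodge–Tate weights of an L-algebraic infinity type are integers
(Buzzard–Gee 2014, Conjecture 3.2.2 and Remark 3.1.3). [cite: BuzzardGee2014, Conjecture 3.2.2 and Remark 3.1.3] -/
theorem hodgeTateWeights_mem_int_of_isLAlgebraic {T : InfinityType K n} (hT : T.IsLAlgebraic)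
    (σ : K →+* ℂ) {w : ℂ} (hw : w ∈ T.hodgeTateWeights σ) : ∃ m : ℤ, w = m := by
  obtain ⟨p, hp, rfl⟩ := Multiset.mem_map.mp hw
  obtain ⟨k, -, hk, -⟩ := hT σ p hp
  exact ⟨-k, by rw [hk]; push_cast; ring⟩

/-- A regular infinity type has pairwise distinct Hodge–Tate weights at every embedding
(Clozel 1990, Définition 3.12; Buzzard–Gee 2014, §3.1). [cite: Clozel1990, Définition 3.12] -/
theorem IsRegular.nodup_hodgeTateWeights {T : InfinityType K n} (hT : T.IsRegular)
    (σ : K →+* ℂ) : (T.hodgeTateWeights σ).Nodup := by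
  have h : T.hodgeTateWeights σ = ((T σ).map ArchWeight.a).map Neg.neg := by
    simp [hodgeTateWeights, Multiset.map_map]
  rw [h]
  exact (hT σ).map neg_injective

end InfinityType

end Literature.NumberTheory.Automorphic
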